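import Summits.Ventures.CertifiedArithmetic.LowPrec.DoubleRoundingFMANearWideFar

/-!
# Double rounding of the FMA through a register with `P_ψ = 3 P_φ - 1` — the slip frame

HONEST FRAMING: certified error envelopes and provably optimal rounding/accumulation schemes for
low-precision formats under stated cost models; every table by two implementations; no hardware
or vendor claims.

THEOREM D-fma-W′, the record-level half of the soundness proof (`nearWide_slip_sig`): with
`F_φ ⊆ F_ψ`, `m_ψ = 3 m_φ + 1` (`P_ψ = 3 P_φ - 1`), `bias_φ ≤ bias_ψ`, `L_ψ ≤ 2 L_φ`,
`L_ψ + P_ψ ≤ L_φ`, `m_φ ≥ 1`, a slip of `fl_φ ∘ fl_ψ` at `x = a·b + c > 0` (`a·b ≠ 0`) puts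
`fl_ψ x` on the midpoint above a NORMAL datum `v` of `φ` whose upper neighbour is finite, and the
odd parts `a₁`, `b₁` of the significands of `a`, `b` satisfy one of

* (A) the binade of `v` is `≥ 2^(m_ψ+1)` quanta and `a₁·b₁ = 2^P_φ + 2·man v + 1` (pattern A1:
  the product IS the midpoint) or `a₁·b₁ = fmaTieSig m_φ (2^m_φ + man v)` (pattern A2: the sum is
  a tie of `ψ` one half-spacing of `ψ` off the midpoint, on the side the parity of `man v` allows);
* (B′) the binade of `v` has exponent code `≥ m_φ + 4 - bias_φ` and `a₁·b₁ = 2^(2P_φ-1) ∓ 1`.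

The anatomy (units `ν = quantum ψ / 2`, integers `P`, `C`, `M = (2V'+1)·2^g`, `0 < |P+C-M| ≤ 2^t`,
`|C - M| ≥ 2^g`) is that of `dFma_wide_pos` (THEOREM D-fma-W); the classification is the integer
core `fma_slip_core_nearWide'`; the parity step is `toRat_roundNE_gmid_eq_of_parity`.  The tests
that exclude (A) and (B′) on the record, and `DFma`, are `DoubleRoundingFMANearWide.lean`.
Implementation A = `code/enum/fma_nearwide_law.py` (certificate `DOUBLE-ROUNDING-FMA-NEARWIDE.json`).

References: [MartinDorelMelquiondMuller2013] Property 2.1; [BoldoMelquiond2008] Thm 3;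
[Figueroa1995] §3; [Roux2014] §2.  No hardware or vendor claims.
-/

namespace Summit.Ventures.CertifiedArithmetic

open Literature.ComputerArithmetic.FloatingPoint
open Literature.ComputerArithmetic.FloatingPoint.Format
open Literature.ComputerArithmetic.FloatingPoint.MiniFloat

set_option maxHeartbeats 800000 in
/-- THEOREM D-fma-W′, the slip frame (positive inputs, nonzero product): a slip of `fl_φ ∘ fl_ψ`
at `a·b + c` sits at the midpoint above a normal datum `v` with `v + ulp ≤ maxRat φ`, and the odd
parts `a₁, b₁` of the significands of `a, b` show pattern (A1)/(A2) in a binade `≥ 2^(m_ψ+1)`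
quanta, or pattern (B′) in a binade of exponent code `≥ m + 4 - bias`. [this packet] -/
theorem nearWide_slip_sig {φ ψ : Format} (hE : embedsTest φ ψ = true)
    (hm : ψ.manBits = 3 * φ.manBits + 1) (hb : φ.bias ≤ ψ.bias)
    (hq2 : ψ.qexp ≤ 2 * φ.qexp) (hnorm : ψ.qexp + ψ.manBits + 1 ≤ φ.qexp) (h1 : 1 ≤ φ.manBits)
    {a b c : MiniFloat φ} (ha : a.scaledMag ≠ 0) (hb0 : b.scaledMag ≠ 0)
    (hx : 0 < a.toRat * b.toRat + c.toRat)
    (h : (roundNE φ (roundNE ψ (a.toRat * b.toRat + c.toRat)).toRat).toRat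
      ≠ (roundNE φ (a.toRat * b.toRat + c.toRat)).toRat) :
    ∃ v : MiniFloat φ, ∃ a₁ b₁ : ℕ, 1 ≤ v.expCode
      ∧ (2 ^ φ.manBits + v.man + 1) * 2 ^ (v.expCode - 1) ≤ φ.maxScaled
      ∧ Odd a₁ ∧ Odd b₁ ∧ a₁ < 2 ^ (φ.manBits + 1) ∧ b₁ < 2 ^ (φ.manBits + 1)
      ∧ ((ψ.manBits + 1 ≤ φ.manBits + (v.expCode - 1)
            ∧ (a₁ * b₁ = 2 ^ (φ.manBits + 1) + 2 * v.man + 1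
                ∨ a₁ * b₁ = fmaTieSig φ.manBits (2 ^ φ.manBits + v.man)))
          ∨ (φ.manBits + 3 - φ.bias ≤ v.expCode - 1
            ∧ (a₁ * b₁ = 2 ^ (2 * (φ.manBits + 1) - 1) - 1
                ∨ a₁ * b₁ = 2 ^ (2 * (φ.manBits + 1) - 1) + 1))) := by
  set x := a.toRat * b.toRat + c.toRat with hxdef
  have hQφ := φ.quantum_pos; have hQ := ψ.quantum_pos
  have hq : ψ.qexp ≤ φ.qexp := by omega
  obtain ⟨zM, hzM⟩ := exists_toRat_eq_maxRat_of_test hE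
  have hmax : φ.maxRat ≤ ψ.maxRat := hzM ▸ (le_abs_self _).trans (abs_toRat_le_maxRat zM)
  -- the slip anatomy in `φ` (as in `dFma_wide_pos`): `fl_ψ x = (v+u)/2`, `u = v + G`
  obtain ⟨v, u, hv0, hvx, hxu, hgap, hmid, hxm⟩ := slip_midpoint_of_pos (by omega) hb hmax hx h
  set y := roundNE ψ x with hydef
  obtain ⟨u', hu'⟩ := exists_toRat_eq_add_ulp hv0 (hvx.trans hxu)
  have hule := add_ulp_le_of_lt hv0 (hvx.trans hxu)
  have hGpos : (0:ℚ) < 2 ^ (v.expCode - 1) * φ.quantum := by positivity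
  have hueq : u.toRat = v.toRat + 2 ^ (v.expCode - 1) * φ.quantum := by
    rcases hgap u' with h1 | h1 <;> linarith
  have hutop : u.toRat ≤ 2 ^ (φ.manBits + 1 + (v.expCode - 1)) * φ.quantum :=
    hueq ▸ toRat_add_ulp_le hv0
  have humax : u.toRat ≤ φ.maxRat := (le_abs_self _).trans (abs_toRat_le_maxRat u)
  have hyu : y.toRat < u.toRat := by rw [hmid]; linarith
  have hy0 : 0 ≤ y.toRat := by rw [hmid]; linarith
  -- quanta: `quantum φ = 2^D quantum ψ`, `quantum φ² = 2^S quantum ψ`, `ν = quantum ψ / 2`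
  set D := (φ.qexp - ψ.qexp).toNat with hDdef
  have hDq : φ.quantum = 2 ^ D * ψ.quantum := quantum_eq_two_pow_mul hq
  have hD1 : ψ.manBits + 1 ≤ D := by omega
  set S := (2 * φ.qexp - ψ.qexp).toNat with hSdef
  have hS0 : ((S : ℕ) : ℤ) = 2 * φ.qexp - ψ.qexp := by
    rw [hSdef]; exact Int.toNat_of_nonneg (by omega)
  have hSq : φ.quantum * φ.quantum = 2 ^ S * ψ.quantum := by
    unfold Format.quantum
    rw [← zpow_natCast, ← zpow_add₀ two_ne_zero, ← zpow_add₀ two_ne_zero, hS0]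
    congr 1; ring
  set ν : ℚ := ψ.quantum / 2 with hνdef
  have hν : 0 < ν := by positivity
  have hQν : ψ.quantum = 2 * ν := by rw [hνdef]; ring
  -- the integers
  have hyQ : y.toRat = (y.scaledMag : ℚ) * ψ.quantum := by
    rw [toRat_eq_toInt_mul, toInt_eq_scaledMag_of_nonneg hy0]; push_cast; rfl
  have hvQ : v.toRat = (v.scaledMag : ℚ) * φ.quantum := by
    rw [toRat_eq_toInt_mul, toInt_eq_scaledMag_of_nonneg hv0]; push_cast; rfl
  obtain ⟨V', hV'⟩ := pow_ulpExp_dvd_scaledMag v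
  set g := (v.expCode - 1) + D with hgdef
  set M : ℤ := 2 * (y.scaledMag : ℤ) with hMdef
  have hmν : y.toRat = (M : ℚ) * ν := by rw [hyQ, hMdef, hQν]; push_cast; ring
  have hGν : 2 ^ (v.expCode - 1) * φ.quantum = 2 * (2:ℚ) ^ g * ν := by
    rw [hDq, hQν, hgdef, pow_add]; ring
  have hMg : M = (2 * (V' : ℤ) + 1) * 2 ^ g := by
    have h1 : (M : ℚ) * ν = ((2 * (V' : ℤ) + 1) * 2 ^ g : ℤ) * ν := by
      rw [← hmν, hmid, hueq, hvQ, hV', hGν, hDq, hQν, hgdef]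
      push_cast; ring
    exact_mod_cast mul_right_cancel₀ (ne_of_gt hν) h1
  -- the result is normal in `ψ`: `expCode ≥ 1`
  have hE1 : 1 ≤ y.expCode := by
    by_contra h0
    have h0 : y.expCode = 0 := by omega
    have hlt : y.scaledMag < 2 ^ ψ.manBits := by
      have := y.man_lt; unfold scaledMag; rw [h0, Format.scaled_zero]; exact this
    have h1 : φ.quantum ≤ 2 ^ (v.expCode - 1) * φ.quantum :=
      le_mul_of_one_le_left hQφ.le (one_le_pow₀ (by norm_num))
    have h2 : (2:ℚ) ^ D * ψ.quantum ≤ (2 * y.scaledMag : ℚ) * ψ.quantum := by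
      rw [← hDq, mul_assoc, ← hyQ, hmid, hueq]; linarith
    have h3 : (2 ^ D : ℕ) ≤ 2 * y.scaledMag := by exact_mod_cast le_of_mul_le_mul_right h2 hQ
    have h4 : 2 ^ (ψ.manBits + 1) ≤ 2 ^ D := Nat.pow_le_pow_right (by norm_num) hD1
    rw [pow_succ] at h4; omega
  set t := y.expCode - 1 with htdef
  have hSy_lo : 2 ^ (ψ.manBits + t) ≤ y.scaledMag := pow_le_scaledMag_of_expCode_pos y hE1
  -- (a) correct rounding in `ψ`: `|x - m| ≤ 2^t ν`
  have hyz : y.toRat < zM.toRat := by rw [hzM]; linarith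
  have habs : |x - y.toRat| ≤ 2 ^ t * ν := by
    have := abs_sub_roundNE_le_half_ulp hy0 hyz hE1
    rw [← hydef, hQν] at this; convert this using 1; rw [htdef]; ring
  -- `x = (P + C) ν`, `c = C ν`
  set P : ℤ := a.toInt * b.toInt * 2 ^ (S + 1) with hPdef
  set C : ℤ := c.toInt * 2 ^ (D + 1) with hCdef
  have hxν : x = ((P + C : ℤ) : ℚ) * ν := by
    calc x = (a.toInt * b.toInt : ℚ) * (φ.quantum * φ.quantum) + c.toInt * φ.quantum := by
          rw [hxdef, toRat_eq_toInt_mul, toRat_eq_toInt_mul, toRat_eq_toInt_mul]; ring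
      _ = (a.toInt * b.toInt : ℚ) * (2 ^ S * (2 * ν)) + c.toInt * (2 ^ D * (2 * ν)) := by
          rw [hSq, hDq, hQν]
      _ = ((P + C : ℤ) : ℚ) * ν := by rw [hPdef, hCdef]; push_cast; ring
  have hcν : c.toRat = (C : ℚ) * ν := by
    rw [toRat_eq_toInt_mul, hCdef, hDq, hQν]; push_cast; ring
  -- `N = P + C - M ≠ 0`, `|N| ≤ 2^t`
  have hN0 : P + C - M ≠ 0 := by
    intro h0; apply hxm; rw [hxν, hmν]; congr 1; exact_mod_cast (sub_eq_zero.mp h0)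
  have hNle : |P + C - M| ≤ (2:ℤ) ^ t := by
    have h1 : (|((P + C - M : ℤ) : ℚ)|) * ν ≤ (2:ℚ) ^ t * ν := by
      rw [← abs_of_pos hν, ← abs_mul, abs_of_pos hν]
      have e : ((P + C - M : ℤ) : ℚ) * ν = x - y.toRat := by rw [hxν, hmν]; push_cast; ring
      rw [e]; exact habs
    exact_mod_cast le_of_mul_le_mul_right h1 hν
  -- `v = (M - 2^g) ν`, `u = (M + 2^g) ν`, hence `|C - M| ≥ 2^g`
  have hvν : v.toRat = ((M : ℚ) - 2 ^ g) * ν := by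
    have e : v.toRat = y.toRat - 2 ^ (v.expCode - 1) * φ.quantum / 2 := by rw [hmid, hueq]; ring
    rw [e, hmν, hGν]; ring
  have huν : u.toRat = ((M : ℚ) + 2 ^ g) * ν := by rw [hueq, hvν, hGν]; ring
  have hfar : (2:ℤ) ^ g ≤ |C - M| := by
    rcases hgap c with h1 | h1
    · rw [hcν, hvν] at h1
      have h3 : (C : ℤ) ≤ M - 2 ^ g := by exact_mod_cast le_of_mul_le_mul_right h1 hν
      rw [abs_sub_comm]; exact le_trans (by linarith) (le_abs_self _)
    · rw [hcν, huν] at h1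
      have h3 : M + 2 ^ g ≤ (C : ℤ) := by exact_mod_cast le_of_mul_le_mul_right h1 hν
      exact le_trans (by linarith) (le_abs_self _)
  -- binade bookkeeping: `2^(m_ψ+t+1) ≤ M < 2^(m_ψ+t+2)`, `M < 2^(m_φ+1+g+1)`
  have hMlt : M < (2:ℤ) ^ (φ.manBits + 1 + g + 1) := by
    have h1 : (M : ℚ) * ν < (2:ℚ) ^ (φ.manBits + 1 + g + 1) * ν := by
      rw [← hmν]
      calc y.toRat < u.toRat := hyu
        _ ≤ 2 ^ (φ.manBits + 1 + (v.expCode - 1)) * φ.quantum := hutop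
        _ = (2:ℚ) ^ (φ.manBits + 1 + g + 1) * ν := by
            rw [hDq, hQν, hgdef]; simp only [pow_add, pow_one]; ring
    exact_mod_cast lt_of_mul_lt_mul_right h1 hν.le
  have hMge : (2:ℤ) ^ (ψ.manBits + t + 1) ≤ M := by
    have h1 : ((2 ^ (ψ.manBits + t) : ℕ) : ℤ) ≤ y.scaledMag := by exact_mod_cast hSy_lo
    push_cast at h1
    rw [hMdef, pow_succ]; linarith
  have hMlt2 : M < (2:ℤ) ^ (ψ.manBits + t + 2) := by
    have h2 : ((y.scaledMag : ℕ) : ℤ) < 2 ^ (ψ.manBits + 1 + t) := by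
      exact_mod_cast scaledMag_lt_pow_ulpExp y
    rw [hMdef, show ψ.manBits + t + 2 = (ψ.manBits + 1 + t) + 1 by omega, pow_succ]; linarith
  have hexp : ψ.manBits + t < φ.manBits + 1 + g := by
    have := (pow_lt_pow_iff_right₀ (by norm_num : (1:ℤ) < 2)).mp (hMge.trans_lt hMlt); omega
  -- the product: `2^k ∣ P` (`k` exact), `|P| ≤ (2^P_φ - 1)² 2^k`
  obtain ⟨αa, a₁, ha₁, haα, ha₁lt⟩ := exists_odd_part a ha
  obtain ⟨αb, b₁, hb₁, hbα, hb₁lt⟩ := exists_odd_part b hb0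
  set k := αa + αb + (S + 1) with hkdef
  have h2w : ∀ i : ℕ, ((2:ℤ) ^ i).natAbs = 2 ^ i := fun i => by rw [Int.natAbs_pow]; rfl
  have hPabs : P.natAbs = 2 ^ k * (a₁ * b₁) := by
    rw [hPdef, Int.natAbs_mul, Int.natAbs_mul, natAbs_toInt, natAbs_toInt, h2w, haα, hbα, hkdef]
    simp only [pow_add]; ring
  have hkP : (2:ℤ) ^ k ∣ P := by
    rw [← Int.natAbs_dvd_natAbs, h2w, hPabs]; exact Dvd.intro _ rfl
  have hPle : |P| ≤ ((2:ℤ) ^ (φ.manBits + 1) - 1) ^ 2 * 2 ^ k := by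
    rw [Int.abs_eq_natAbs, hPabs]; push_cast
    have h1 : (a₁ : ℤ) + 1 ≤ 2 ^ (φ.manBits + 1) := by exact_mod_cast ha₁lt
    have h2 : (b₁ : ℤ) + 1 ≤ 2 ^ (φ.manBits + 1) := by exact_mod_cast hb₁lt
    have h12 : (a₁ : ℤ) * b₁ ≤ (2 ^ (φ.manBits + 1) - 1) ^ 2 := by
      rw [sq]; exact mul_le_mul (by linarith) (by linarith) (by positivity) (by linarith)
    rw [mul_comm]; exact mul_le_mul_of_nonneg_right h12 (by positivity)
  have hCγ : (2:ℤ) ^ (D + 1) ∣ C := by rw [hCdef]; exact dvd_mul_left _ _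
  -- the addend: `|C| = c₁ 2^γ`, `c₁ < 2^P_φ`; coarse (`2^(t+1) ∣ C`) or small
  obtain ⟨γ, c₁, hC1, hc₁, hC⟩ : ∃ γ : ℕ, ∃ c₁ : ℤ, |C| = c₁ * 2 ^ γ ∧ c₁ < 2 ^ (φ.manBits + 1)
      ∧ ((2:ℤ) ^ (t + 1) ∣ C ∨ |C| ≤ ((2:ℤ) ^ (φ.manBits + 1) - 1) * 2 ^ t) := by
    by_cases hc0 : c.scaledMag = 0
    · have hC0 : C = 0 := by rw [hCdef]; simp [MiniFloat.toInt, hc0]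
      exact ⟨0, 0, by rw [hC0]; simp, by positivity, Or.inl (by rw [hC0]; exact dvd_zero _)⟩
    · obtain ⟨αc, c₁, hc₁, hcα, hc₁lt⟩ := exists_odd_part c hc0
      have hCabs : C.natAbs = 2 ^ (αc + (D + 1)) * c₁ := by
        rw [hCdef, Int.natAbs_mul, natAbs_toInt, h2w, hcα, pow_add]; ring
      refine ⟨αc + (D + 1), c₁, ?_, by exact_mod_cast hc₁lt, ?_⟩
      · rw [Int.abs_eq_natAbs, hCabs]; push_cast; ring
      · by_cases hw : t + 1 ≤ αc + (D + 1)
        · left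
          rw [← Int.natAbs_dvd_natAbs, h2w, hCabs]
          exact Dvd.dvd.mul_right (pow_dvd_pow 2 hw) _
        · right
          rw [Int.abs_eq_natAbs, hCabs]; push_cast
          have h1 : (c₁ : ℤ) + 1 ≤ 2 ^ (φ.manBits + 1) := by exact_mod_cast hc₁lt
          have h2 : (2:ℤ) ^ (αc + (D + 1)) ≤ 2 ^ t :=
            pow_le_pow_right₀ (by norm_num) (by omega)
          calc (2:ℤ) ^ (αc + (D + 1)) * c₁ ≤ 2 ^ t * c₁ :=
                mul_le_mul_of_nonneg_right h2 (by positivity)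
            _ ≤ 2 ^ t * (2 ^ (φ.manBits + 1) - 1) :=
                mul_le_mul_of_nonneg_left (by linarith) (by positivity)
            _ = (2 ^ (φ.manBits + 1) - 1) * 2 ^ t := mul_comm _ _
  have hV'lt : V' < 2 ^ (φ.manBits + 1) := by
    have h1 := scaledMag_lt_pow_ulpExp v
    rw [hV', pow_add, mul_comm (2 ^ (φ.manBits + 1))] at h1
    exact Nat.lt_of_mul_lt_mul_left h1
  have hMge2 : (2:ℤ) ^ (t + 3 * (φ.manBits + 1)) ≤ 2 * M := by
    rw [show t + 3 * (φ.manBits + 1) = (ψ.manBits + t + 1) + 1 by omega, pow_succ]; linarith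
  -- THE CORE: patterns (A1) | (A2) | (B′)
  have hcase := fma_slip_core_nearWide' (p := φ.manBits + 1) (by omega) hkP hPle hC1 hc₁ hC hMg
    (by omega) hMge2 hN0 hNle hfar
  -- the A-patterns put the midpoint in a binade `≥ 2^(m_ψ+1)` quanta: `t ≥ D + 1`
  have hp1odd : Odd ((2:ℤ) ^ (φ.manBits + 1) - 1) :=
    Even.sub_odd ⟨2 ^ φ.manBits, by rw [pow_succ]; ring⟩ odd_one
  have htD : (P = M ∨ ∃ ρ : ℤ, (ρ = 1 ∨ ρ = -1) ∧ P = M - ρ * 2 ^ (t + (φ.manBits + 1))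
      ∧ C = ρ * (2 ^ (φ.manBits + 1) - 1) * 2 ^ t) → D + 1 ≤ t := by
    rintro (hPM | ⟨ρ, hρ, -, hCρ⟩)
    · have hNC : P + C - M = C := by rw [hPM]; ring
      have hN0' := hN0; have hNle' := hNle
      rw [hNC] at hN0' hNle'
      exact (pow_le_pow_iff_right₀ (by norm_num : (1:ℤ) < 2)).mp
        ((Int.le_of_dvd (abs_pos.mpr hN0') ((dvd_abs _ _).mpr hCγ)).trans hNle')
    · have hρodd : Odd ρ := by rcases hρ with rfl | rfl <;> decide
      exact succ_le_of_two_pow_dvd_odd_mul (hρodd.mul hp1odd) (hCρ ▸ hCγ)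
  have hwinA : D + 1 ≤ t → ψ.manBits + 1 ≤ φ.manBits + (v.expCode - 1) :=
    fun hd => manBits_succ_le_of_frame hMge hMg hV'lt hgdef hd
  -- `v` is normal in every pattern
  have he1 : 1 ≤ v.expCode := by
    rcases hcase with hPM | hA2 | ⟨σ, ε, -, -, -, -, -, hg1⟩
    · have := hwinA (htD (Or.inl hPM)); omega
    · have := hwinA (htD (Or.inr hA2)); omega
    · by_contra he0
      have he0 : v.expCode = 0 := by omega
      have hV'm : V' < 2 ^ φ.manBits := by
        have h2 : v.scaledMag < 2 ^ φ.manBits := by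
          unfold scaledMag Format.scaled; rw [if_pos he0]; exact v.man_lt
        rw [hV', he0] at h2; simpa using h2
      have h3 : M < (2:ℤ) ^ (φ.manBits + 1) * 2 ^ g := by
        rw [hMg]
        have h' : ((V' : ℕ) : ℤ) < 2 ^ φ.manBits := by exact_mod_cast hV'm
        have h4 : (2 * (V' : ℤ) + 1) < 2 ^ (φ.manBits + 1) := by rw [pow_succ]; linarith
        exact mul_lt_mul_of_pos_right h4 (pow_pos (by norm_num : (0:ℤ) < 2) g)
      rw [← pow_add] at h3
      have h5 := (pow_lt_pow_iff_right₀ (by norm_num : (1:ℤ) < 2)).mp (hMge.trans_lt h3)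
      omega
  have hVman : V' = 2 ^ φ.manBits + v.man := by
    have h1 : v.scaledMag = (2 ^ φ.manBits + v.man) * 2 ^ (v.expCode - 1) := by
      unfold scaledMag Format.scaled; rw [if_neg (by omega)]
    rw [hV', mul_comm] at h1
    exact Nat.eq_of_mul_eq_mul_right (by positivity) h1
  have hu_nat : (2 ^ φ.manBits + v.man + 1) * 2 ^ (v.expCode - 1) ≤ φ.maxScaled := by
    have h1 : u.toRat ≤ φ.maxRat := humax
    rw [hueq, hvQ, hV', hVman] at h1
    unfold Format.maxRat at h1
    have h2 : ((2 ^ (v.expCode - 1) * (2 ^ φ.manBits + v.man) : ℕ) : ℚ) * φ.quantum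
          + 2 ^ (v.expCode - 1) * φ.quantum
        = (((2 ^ φ.manBits + v.man + 1) * 2 ^ (v.expCode - 1) : ℕ) : ℚ) * φ.quantum := by
      push_cast; ring
    rw [h2] at h1
    exact_mod_cast le_of_mul_le_mul_right h1 hQφ
  -- the binade of the midpoint exactly: `g = t + 2m + 1`
  have hgeq : g = t + (φ.manBits + 1) + φ.manBits := by
    have h3 : (2:ℤ) ^ (φ.manBits + 1) * 2 ^ g < M := by
      rw [hMg]
      have h' : (2:ℤ) ^ φ.manBits ≤ V' := by rw [hVman]; push_cast; linarith
      have h4 : (2:ℤ) ^ (φ.manBits + 1) < 2 * (V' : ℤ) + 1 := by rw [pow_succ]; linarith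
      exact mul_lt_mul_of_pos_right h4 (pow_pos (by norm_num : (0:ℤ) < 2) g)
    rw [← pow_add] at h3
    have h5 := (pow_lt_pow_iff_right₀ (by norm_num : (1:ℤ) < 2)).mp (h3.trans hMlt2)
    omega
  have hodd : Odd (a₁ * b₁) := Nat.odd_mul.mpr ⟨ha₁, hb₁⟩
  refine ⟨v, a₁, b₁, he1, hu_nat, ha₁, hb₁, ha₁lt, hb₁lt, ?_⟩
  rcases hcase with hPM | ⟨ρ, hρ, hPρ, hCρ⟩ | ⟨σ, ε, hσ, hε, -, hPσ, hkt, -⟩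
  · -- (A1): the product is the midpoint, `a₁ b₁ = 2V' + 1`
    left
    refine ⟨hwinA (htD (Or.inl hPM)), Or.inl ?_⟩
    rcases sig_of_A (p := φ.manBits + 1) (t := t) h1 (Or.inl rfl) (by rw [hPM]; ring) hMg hgeq
      hPabs hodd with ⟨-, hO⟩ | ⟨h0, -⟩
    · rw [hO, hVman, pow_succ]; ring
    · exact absurd rfl h0
  · -- (A2): a tie of `ψ` one half-spacing off the midpoint; parity decides the side
    left
    have hwin := hwinA (htD (Or.inr ⟨ρ, hρ, hPρ, hCρ⟩))
    refine ⟨hwin, Or.inr ?_⟩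
    have hO : ((a₁ * b₁ : ℕ) : ℤ) = (2 * V' + 1) * 2 ^ φ.manBits - ρ := by
      rcases sig_of_A h1 (Or.inr hρ) hPρ hMg hgeq hPabs hodd with ⟨h0, -⟩ | ⟨-, hO⟩
      · rcases hρ with h | h <;> omega
      · exact hO
    -- the frame of the midpoint: `y = (2V'+1)·2^k'·quantum φ`, `x = y - ρ·2^t ν`
    obtain ⟨k', he2'⟩ : ∃ k' : ℕ, v.expCode - 1 = k' + 1 := ⟨v.expCode - 2, by omega⟩
    have hμ : y.toRat = (((2 * V' + 1) * 2 ^ k' : ℕ) : ℚ) * φ.quantum := by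
      rw [hmid, hueq, hvQ, hV', he2']; push_cast; ring
    have hNρ : P + C - M = -ρ * 2 ^ t := by
      rw [pow_add] at hPρ; linear_combination hPρ + hCρ
    have hxy : x = y.toRat - ρ * (2 ^ t * ν) := by
      rw [hxν, hmν, show P + C = (P + C - M) + M by ring, hNρ]; push_cast; ring
    have hδlt : (2:ℚ) ^ t * ν < 2 ^ k' * φ.quantum := by
      have h2 : (2:ℚ) ^ t < 2 ^ (k' + D + 1) := pow_lt_pow_right₀ (by norm_num) (by omega)
      calc (2:ℚ) ^ t * ν < 2 ^ (k' + D + 1) * ν := mul_lt_mul_of_pos_right h2 hν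
        _ = 2 ^ k' * φ.quantum := by rw [hDq, hQν, pow_add, pow_succ]; ring
    have hu' : (V' + 1) * 2 ^ (k' + 1) ≤ φ.maxScaled := by rw [hVman, ← he2']; exact hu_nat
    -- the wrong parity would round `y` and `x` alike in `φ`: no slip
    have hpar : ¬ ((ρ = 1 ∧ Even V') ∨ (ρ = -1 ∧ Odd V')) := by
      intro hpar
      have heq := toRat_roundNE_gmid_eq_of_parity h1 (by rw [hVman]; omega) hV'lt hu'
        (by positivity) hδlt hpar
      exact h (by rw [hxy, hμ]; exact heq)
    have hTie : ((fmaTieSig φ.manBits V' : ℕ) : ℤ) = (2 * V' + 1) * 2 ^ φ.manBits - ρ := by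
      rw [fmaTieSig_eq]; congr 1
      rcases hρ with rfl | rfl
      · have hoddV : Odd V' := by
          by_contra hev; exact hpar (Or.inl ⟨rfl, Nat.not_odd_iff_even.mp hev⟩)
        rw [if_pos (Nat.odd_iff.mp hoddV)]
      · have hevV : Even V' := by
          by_contra hov; exact hpar (Or.inr ⟨rfl, Nat.not_even_iff_odd.mp hov⟩)
        rw [if_neg (by rw [Nat.even_iff.mp hevV]; omega)]
    rw [← hVman]; exact_mod_cast hO.trans hTie.symm
  · -- (B′): `k = t`, `a₁ b₁ = 2^(2m+1) ∓ 1`, in a binade of exponent code `≥ m + 4 - bias`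
    right
    rw [hkt] at hPabs
    have hsig := sig_of_Bprime (m := φ.manBits) hσ hε hPσ (by omega) hPabs
    have hqφ : φ.qexp = 1 - (φ.bias : ℤ) - φ.manBits := rfl
    have hD0 : ((D : ℕ) : ℤ) = φ.qexp - ψ.qexp := by
      rw [hDdef]; exact Int.toNat_of_nonneg (by omega)
    refine ⟨by omega, ?_⟩
    rw [show 2 * (φ.manBits + 1) - 1 = 2 * φ.manBits + 1 by omega]; exact hsig

end Summit.Ventures.CertifiedArithmetic
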